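import Literature.Analysis.FluidPDE.KatoLaiGalerkin
import Literature.Analysis.FunctionSpaces.DiagonalWeakLimits
import Mathlib.Analysis.Normed.Operator.BanachSteinhaus
import Mathlib.Topology.Sequences
import Mathlib.Analysis.InnerProductSpace.Projection.Submodule
import HarnessLib

/-!
# Kato–Lai 1984, Theorem A — Step 2 of the proof, first half: weak-continuity lemmas and the
  nested Galerkin sequence

Topic `Literature/Analysis/FluidPDE`. Theorem-only module continuing `KatoLaiGalerkin` (§8 Step 1,
`KatoLai.galerkin_exists`) towards the discharge of the named fact
`Literature.Analysis.FluidPDE.KatoLai1984_thmA` (`KatoLaiAbstractEvolution.lean`; T. Kato,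
C. Y. Lai, *Nonlinear evolution equations and the Euler flow*, J. Funct. Anal. **56** (1984)
15–28, Thm A p. 18, proof §8 pp. 25–27), completed in `KatoLaiAbstractEvolutionProofs`:

* **Consequences of sequential weak continuity of `A : I_{T₀} × H → X`**
  (`KatoLai.IsSeqWeaklyContinuousOn`): weak continuity of `t ↦ A(t, w(t))` along a weakly
  continuous curve (`continuousOn_comp`; "`A(t, u(t)) ∈ X` is weakly continuous in `t`", p. 27),
  weak boundedness of `A` on `I × B̄(0, K)` ("since `A` is weakly continuous on `I_{T₀} × H` to
  `X`, it is bounded (maps bounded sets into bounded sets)", p. 27; `exists_bound`, by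
  contradiction through a weakly convergent subsequence in the separable Hilbert space `H`,
  `FunctionSpaces.exists_mem_tendsto_inner_of_subset_closure_span`), and the Banach–Steinhaus
  bound `|⟨v, A(s, u(s))⟩| ≤ C‖v‖_V` along a weakly continuous `u` on a compact interval
  (`AdmissibleTriplet.exists_abs_pairing_le`), which is what "this extends … to all `v ∈ V`"
  (p. 27) uses.
* **§8 Step 2, the nested Galerkin sequence** (`KatoLai.exists_galerkin_sequence`): for a dense
  sequence `d₀, d₁, …` of `V` and `M_j = span{d₀, …, d_j}` ("finite-dimensional subspaces of `V`
  such that their union is dense in `V`, hence in `H` too", p. 26), the solutions `u_j` of (8.5)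
  on `I_T` from `galerkin_exists` (in an `H`-orthonormal basis of `M_j ⊂ H`, `stdOrthonormalBasis`,
  pulled back to `V` along the injective inclusion) satisfy `‖u_j(t)‖² ≤ p(t)` (8.6),
  `u_j(0) = P_jφ → φ` strongly ("`P_j → 1` strongly on `H`", `Submodule.starProjection_tendsto_self`)
  and the tested equations (8.7) `dₜ(d_k | u_j(t)) = -⟨d_k, A(t, u_j(t))⟩` for `k ≤ j`
  (`pairing_hasDerivWithinAt_of_coord`: "by (8.5), (8.3) and `P_jv = v`").

## References

* T. Kato, C. Y. Lai, *Nonlinear evolution equations and the Euler flow*, J. Funct. Anal. 56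
  (1984) 15–28, §8 Step 2 (pp. 26–27). [cite: KatoLai1984, §8 Step 2 (pp. 26–27)]
-/

noncomputable section

open Set Filter Topology Metric
open scoped RealInnerProductSpace

namespace Literature.Analysis.FluidPDE

namespace KatoLai

variable {V : Type*} {H : Type*} {X : Type*}
  [NormedAddCommGroup V] [NormedSpace ℝ V] [NormedAddCommGroup H] [InnerProductSpace ℝ H]
  [NormedAddCommGroup X] [NormedSpace ℝ X]

/-! ### Consequences of sequential weak continuity -/

/-- **Weak continuity of `t ↦ A(t, w(t))` along a weakly continuous curve.** If `w` is weakly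
continuous on `S' ⊆ S` (every `t ↦ ⟪h, w t⟫` continuous on `S'`) then `t ↦ ℓ(A(t, w t))` is
continuous on `S'` for every `ℓ ∈ X*` (Kato–Lai 1984, end of §8: "`A(t, u(t)) ∈ X` is weakly
continuous in `t`"). [cite: KatoLai1984, §8 Step 2 (p. 27)] -/
theorem IsSeqWeaklyContinuousOn.continuousOn_comp {S S' : Set ℝ} {A : ℝ → H → X}
    (hA : IsSeqWeaklyContinuousOn S A) (hS' : S' ⊆ S) {w : ℝ → H}
    (hw : ∀ h : H, ContinuousOn (fun t => ⟪h, w t⟫) S') (ℓ : StrongDual ℝ X) :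
    ContinuousOn (fun t => ℓ (A t (w t))) S' := by
  rw [continuousOn_iff_continuous_restrict]
  refine continuous_iff_seqContinuous.2 fun x x' hx => ?_
  have h1 : Tendsto (fun n => ((x n : S') : ℝ)) atTop (𝓝 (x' : ℝ)) :=
    (continuous_subtype_val.tendsto x').comp hx
  have h2 : ∀ h : H, Tendsto (fun n => ⟪h, w (x n)⟫) atTop (𝓝 ⟪h, w x'⟫) := fun h =>
    ((continuousOn_iff_continuous_restrict.1 (hw h)).tendsto x').comp hx
  exact hA (fun n => (x n : ℝ)) x' (fun n => w (x n)) (w x') (fun n => hS' (x n).2) (hS' x'.2)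
    h1 h2 ℓ

/-- **Sequentially weakly continuous maps are weakly bounded on bounded sets** (Kato–Lai 1984,
§8 Step 2: "Since `A` is weakly continuous on `I_{T₀} × H` to `X`, it is bounded (maps bounded
sets into bounded sets)"), in the form used: for `ℓ ∈ X*`, a compact time interval
`[a, b] ⊆ S` and a radius `K` there is `C` with `|ℓ(A(t, w))| ≤ C` for `t ∈ [a, b]`, `‖w‖ ≤ K`.
Proof by contradiction: a violating sequence has `tₙ → t'` and, `H` being a separable Hilbert
space, a weakly convergent subsequence `wₙ ⇀ w'` (diagonal extraction on a dense sequence and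
the Riesz representation, `FunctionSpaces.exists_mem_tendsto_inner_of_subset_closure_span`), along
which `ℓ(A(tₙ, wₙ))` converges, hence is bounded. [cite: KatoLai1984, §8 Step 2 (p. 27)] -/
theorem IsSeqWeaklyContinuousOn.exists_bound [CompleteSpace H]
    [TopologicalSpace.SeparableSpace H] {S : Set ℝ} {A : ℝ → H → X}
    (hA : IsSeqWeaklyContinuousOn S A) {a b : ℝ} (hab : Icc a b ⊆ S) (ℓ : StrongDual ℝ X)
    (K : ℝ) : ∃ C, ∀ t ∈ Icc a b, ∀ w : H, ‖w‖ ≤ K → |ℓ (A t w)| ≤ C := by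
  by_contra hcon
  push Not at hcon
  choose t ht w hwK hbig using fun n : ℕ => hcon n
  obtain ⟨d, hd⟩ := TopologicalSpace.exists_dense_seq H
  -- common subsequence along which the times and all pairings with the `d k` converge
  obtain ⟨ψ, hψ, hlim⟩ := FunctionSpaces.exists_strictMono_forall_tendsto_real
    (fun n (i : Option ℕ) => i.elim (t n) fun k => ⟪w n, d k⟫) (by
      rintro (_ | k)
      · refine ⟨max |a| |b|, fun n => ?_⟩
        change |t n| ≤ max |a| |b|
        exact abs_le_max_abs_abs (ht n).1 (ht n).2
      · refine ⟨K * ‖d k‖, fun n => ?_⟩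
        change |⟪w n, d k⟫| ≤ K * ‖d k‖
        exact (abs_real_inner_le_norm _ _).trans
          (mul_le_mul_of_nonneg_right (hwK n) (norm_nonneg _)))
  obtain ⟨t', ht'⟩ := hlim none
  change Tendsto (fun n => t (ψ n)) atTop (𝓝 t') at ht'
  have ht'mem : t' ∈ Icc a b :=
    isClosed_Icc.mem_of_tendsto ht' (Eventually.of_forall fun n => ht _)
  have hD : ((⊤ : Submodule ℝ H) : Set H) ⊆ closure (Submodule.span ℝ (range d) : Set H) := by
    intro z _
    have h1 : closure (range d) ⊆ closure (Submodule.span ℝ (range d) : Set H) :=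
      closure_mono Submodule.subset_span
    exact h1 (by rw [hd.closure_range]; exact mem_univ z)
  obtain ⟨w', -, -, hw'⟩ := FunctionSpaces.exists_mem_tendsto_inner_of_subset_closure_span ⊤
    isClosed_univ hD (v := fun n => w (ψ n)) (fun n => trivial) (M := K) (fun n => hwK _) (by
      rintro _ ⟨k, rfl⟩
      obtain ⟨l, hl⟩ := hlim (some k)
      exact ⟨l, hl⟩)
  have key := hA (fun n => t (ψ n)) t' (fun n => w (ψ n)) w' (fun n => hab (ht _)) (hab ht'mem)
    ht' (fun h => by simpa only [real_inner_comm] using hw' h) ℓ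
  have hdiv : Tendsto (fun n => |ℓ (A (t (ψ n)) (w (ψ n)))|) atTop atTop := by
    refine tendsto_atTop_mono (fun n => ?_) tendsto_natCast_atTop_atTop
    exact (Nat.cast_le.2 (hψ.id_le n)).trans (hbig (ψ n)).le
  exact not_tendsto_atTop_of_tendsto_nhds key.abs hdiv

/-- **Uniform bound on `⟨·, A(s, u(s))⟩ ∈ V*` along a weakly continuous curve** (Banach–Steinhaus
on the Banach space `V`): if `u` is weakly continuous on `[a, b] ⊆ S` then there is `C` with
`|⟨v, A(s, u(s))⟩| ≤ C‖v‖_V` for all `s ∈ [a, b]`, `v ∈ V` (each `s ↦ ⟨v, A(s, u(s))⟩` is continuous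
on the compact interval, hence bounded; this is the boundedness behind "this extends … to all
`v ∈ V`", Kato–Lai 1984, p. 27). [cite: KatoLai1984, §8 Step 2 (p. 27)] -/
theorem AdmissibleTriplet.exists_abs_pairing_le [CompleteSpace V] (𝒯 : AdmissibleTriplet V H X)
    {S : Set ℝ} {A : ℝ → H → X} (hA : IsSeqWeaklyContinuousOn S A) {a b : ℝ}
    (hab : Icc a b ⊆ S) {u : ℝ → H} (hu : ∀ h : H, ContinuousOn (fun t => ⟪h, u t⟫) (Icc a b)) :
    ∃ C, ∀ s ∈ Icc a b, ∀ v : V, |𝒯.pairing v (A s (u s))| ≤ C * ‖v‖ := by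
  have h : ∀ v : V, ∃ C, ∀ s : Icc a b, ‖(𝒯.pairing.flip (A s (u s))) v‖ ≤ C := fun v => by
    have hc : ContinuousOn (fun t => 𝒯.pairing v (A t (u t))) (Icc a b) :=
      hA.continuousOn_comp hab hu (𝒯.pairing v)
    obtain ⟨C, hC⟩ := isCompact_Icc.exists_bound_of_continuousOn hc
    exact ⟨C, fun s => by simpa using hC s s.2⟩
  obtain ⟨C', hC'⟩ := banach_steinhaus h
  refine ⟨C', fun s hs v => ?_⟩
  have h1 := (𝒯.pairing.flip (A s (u s))).le_opNorm v
  rw [ContinuousLinearMap.flip_apply, Real.norm_eq_abs] at h1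
  exact h1.trans (mul_le_mul_of_nonneg_right (hC' ⟨s, hs⟩) (norm_nonneg _))

/-! ### §8 Step 2: the nested Galerkin sequence -/

/-- **The Galerkin equation tested against `M`** (Kato–Lai 1984, (8.7)): if
`dₜ(eᵢ | u(t)) = -⟨eᵢ, A(t, u(t))⟩` for each vector of a finite family `e` in `V`, then for every
`v = ∑ aᵢ eᵢ` in its span `dₜ(v | u(t)) = -⟨v, A(t, u(t))⟩` (linearity of the inclusion
`V → H`, of `(· | ·)_H` and of `⟨·, f⟩`; "by (8.5), (8.3) and `Pⱼv = v`"). [cite: KatoLai1984, §8 Step 2, (8.7) (p. 27)] -/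
theorem pairing_hasDerivWithinAt_of_coord {𝒯 : AdmissibleTriplet V H X} {A : ℝ → H → X}
    {T : ℝ} {m : ℕ} {e : Fin m → V} {u : ℝ → H} {t : ℝ}
    (hu : ∀ i, HasDerivWithinAt (fun s => ⟪𝒯.inclVH (e i), u s⟫)
      (-(𝒯.pairing (e i) (A t (u t)))) (Icc 0 T) t)
    (a : Fin m → ℝ) :
    HasDerivWithinAt (fun s => ⟪𝒯.inclVH (∑ i, a i • e i), u s⟫)
      (-(𝒯.pairing (∑ i, a i • e i) (A t (u t)))) (Icc 0 T) t := by
  have h1 : ∀ s, ⟪𝒯.inclVH (∑ i, a i • e i), u s⟫ = ∑ i, a i * ⟪𝒯.inclVH (e i), u s⟫ :=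
    fun s => by
      rw [map_sum, sum_inner]
      exact Finset.sum_congr rfl fun i _ => by rw [map_smul, real_inner_smul_left]
  simp_rw [h1]
  have h2 := HasDerivWithinAt.fun_sum fun i (_ : i ∈ Finset.univ) => (hu i).const_mul (a i)
  refine h2.congr_deriv ?_
  simp only [map_sum, map_smul, _root_.sum_apply, _root_.smul_apply, smul_eq_mul, mul_neg,
    Finset.sum_neg_distrib]

/-- **Kato–Lai 1984, §8 Step 2 (the Galerkin sequence).** Let `d₀, d₁, …` be dense in `V` and
`M_j = span{d₀, …, d_j} ⊂ V` ("finite-dimensional subspaces of `V` such that their union is dense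
in `V`, hence in `H` too"), `P_j` the `H`-orthogonal projection onto `M_j`. Solving the Galerkin
system (8.5) on each `M_j` by `galerkin_exists` (in an `H`-orthonormal basis of `M_j`, pulled back to
`V` along the inclusion) gives `u_j : I_T → M_j ⊂ H` with `‖u_j(t)‖² ≤ p(t)` (8.6),
`u_j(0) = P_j φ → φ` ("`P_j → 1` strongly on `H`", `Submodule.starProjection_tendsto_self`),
`u_j` continuous, and the tested equations (8.7) `dₜ(d_k | u_j(t)) = -⟨d_k, A(t, u_j(t))⟩` for
`k ≤ j`. [cite: KatoLai1984, §8 Step 2, (8.5)–(8.7) (pp. 26–27)] -/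
theorem exists_galerkin_sequence [CompleteSpace H] (𝒯 : AdmissibleTriplet V H X) {T₀ : ℝ}
    {A : ℝ → H → X} {β : ℝ → ℝ} (hA : IsSeqWeaklyContinuousOn (Icc 0 T₀) A)
    (hcoercive : ∀ t ∈ Icc 0 T₀, ∀ v : V,
      -β (‖𝒯.inclVH v‖ ^ 2) ≤ 𝒯.pairing v (A t (𝒯.inclVH v)))
    (φ : H) {T : ℝ} (hT : 0 < T) (hTT₀ : T ≤ T₀) {p p' : ℝ → ℝ}
    (hp : ∀ t ∈ Icc 0 T, HasDerivWithinAt p (p' t) (Icc 0 T) t) (hp0 : ‖φ‖ ^ 2 ≤ p 0)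
    (hsuper : ∀ t ∈ Icc 0 T, 2 * β (p t) < p' t) {d : ℕ → V} (hd : DenseRange d) :
    ∃ U : ℕ → ℝ → H,
      (∀ j, ∀ t ∈ Icc 0 T, ‖U j t‖ ^ 2 ≤ p t) ∧
      Tendsto (fun j => U j 0) atTop (𝓝 φ) ∧
      (∀ j, ContinuousOn (U j) (Icc 0 T)) ∧
      ∀ k j, k ≤ j → ∀ t ∈ Icc 0 T, HasDerivWithinAt (fun s => ⟪𝒯.inclVH (d k), U j s⟫)
        (-(𝒯.pairing (d k) (A t (U j t)))) (Icc 0 T) t := by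
  classical
  -- the Galerkin spaces `M j = span {d k : k ≤ j}`, seen in `H`
  obtain ⟨M, hM⟩ : ∃ M : ℕ → Submodule ℝ H,
      ∀ j, M j = Submodule.span ℝ ((fun k => 𝒯.inclVH (d k)) '' Iic j) := ⟨_, fun _ => rfl⟩
  have hMfin : ∀ j, FiniteDimensional ℝ (M j) := fun j => by
    rw [hM]
    exact FiniteDimensional.span_of_finite ℝ ((Set.finite_Iic j).image _)
  have hMmono : Monotone M := fun j j' hjj' => by
    rw [hM, hM]
    exact Submodule.span_mono (Set.image_mono (Set.Iic_subset_Iic.2 hjj'))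
  have hdM : ∀ k j, k ≤ j → 𝒯.inclVH (d k) ∈ M j := fun k j hkj => by
    rw [hM]
    exact Submodule.subset_span ⟨k, mem_Iic.2 hkj, rfl⟩
  have hMV : ∀ j, ∀ x ∈ M j, ∃ v : V, 𝒯.inclVH v = x := fun j x hx => by
    have h1 : M j = (Submodule.span ℝ (d '' Iic j)).map (𝒯.inclVH : V →ₗ[ℝ] H) := by
      rw [← Submodule.span_image, ContinuousLinearMap.coe_coe, Set.image_image, hM]
    rw [h1, Submodule.mem_map] at hx
    obtain ⟨v, -, rfl⟩ := hx
    exact ⟨v, rfl⟩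
  -- an `H`-orthonormal basis of each `M j`, pulled back to `V`
  have hstep : ∀ j : ℕ, ∃ (m : ℕ) (e : Fin m → V), Orthonormal ℝ (𝒯.inclVH ∘ e) ∧
      (M j).starProjection φ = ∑ i, ⟪𝒯.inclVH (e i), φ⟫ • 𝒯.inclVH (e i) ∧
      ∀ k ≤ j, ∃ a : Fin m → ℝ, d k = ∑ i, a i • e i := fun j => by
    haveI := hMfin j
    let b := stdOrthonormalBasis ℝ (M j)
    have hb : ∀ i, ∃ v : V, 𝒯.inclVH v = (b i : H) := fun i => hMV j _ (b i).2
    choose e he using hb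
    refine ⟨_, e, ?_, ?_, fun k hk => ?_⟩
    · have h1 : (𝒯.inclVH ∘ e) = ((M j).subtypeₗᵢ ∘ b) := funext fun i => by simp [he]
      rw [h1]
      exact b.orthonormal.comp_linearIsometry _
    · rw [Submodule.starProjection_apply, b.orthogonalProjectionOnto_apply_eq_sum φ,
        Submodule.coe_sum]
      exact Finset.sum_congr rfl fun i _ => by rw [Submodule.coe_smul, he]
    · refine ⟨fun i => ⟪(b i : H), 𝒯.inclVH (d k)⟫, 𝒯.injective_inclVH ?_⟩
      have hy := congrArg Subtype.val (b.sum_repr' ⟨𝒯.inclVH (d k), hdM k j hk⟩)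
      simp only [Submodule.coe_sum, Submodule.coe_smul, Submodule.coe_inner] at hy
      rw [map_sum]
      simp_rw [map_smul, he]
      exact hy.symm
  choose m e he hproj hspan using hstep
  -- the Galerkin solutions (Step 1, `galerkin_exists`)
  choose u hucont hu0 hup _humem huder using
    fun j => galerkin_exists 𝒯 hA hcoercive φ hT hTT₀ hp hp0 hsuper (e j) (he j)
  refine ⟨u, hup, ?_, hucont, fun k j hkj t ht => ?_⟩
  · -- `u_j(0) = P_j φ → φ`
    have h1 : ∀ j, u j 0 = (M j).starProjection φ := fun j => by rw [hproj j, hu0 j]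
    simp_rw [h1]
    haveI : ∀ j, (M j).HasOrthogonalProjection := fun j => by
      haveI := hMfin j
      infer_instance
    refine Submodule.starProjection_tendsto_self M hMmono φ fun z _ => ?_
    have hdense : DenseRange fun k => 𝒯.inclVH (d k) :=
      𝒯.denseRange_inclVH.comp hd 𝒯.inclVH.continuous
    have hsub : range (fun k => 𝒯.inclVH (d k)) ⊆ ((⨆ j, M j : Submodule ℝ H) : Set H) := by
      rintro _ ⟨k, rfl⟩
      exact (le_iSup M k) (hdM k k le_rfl)
    have hz : z ∈ closure (range fun k => 𝒯.inclVH (d k)) := by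
      rw [hdense.closure_range]
      exact mem_univ z
    rw [← SetLike.mem_coe, Submodule.topologicalClosure_coe]
    exact closure_mono hsub hz
  · obtain ⟨a, ha⟩ := hspan j k hkj
    rw [ha]
    exact pairing_hasDerivWithinAt_of_coord (fun i => huder j i t ht) a

end KatoLai

end Literature.Analysis.FluidPDE
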